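import Summits.AtomisticToContinuum.Crystallization.Theorems.ExcessDecayLiouvilleCoarseGrainsPinTail

/-!
# Certified hcp lattice sums: soundness of the integer evaluator — stub `stub_pinNumerics` of line `vanishing-excess-truss-rigidity` (crux `CoarseGrains`, stmt-AtomisticToContinuum-9331)

Soundness of the integer evaluator `hcpSumFloorSum` (defined in `…PinSums`): at a rational layer ratio
`c = p/q` the term is `(3q²)ᵉ / N_vᵉ` with the positive integer `N_v = 3q²Q(v) + 3p²k²`, the structural
loops are `Finset.range` sums, the shifted index ranges re-index the cube `[-K,K]³`, and the floor
terms satisfy `⌊M/Nᵉ⌋ ≤ M/Nᵉ < ⌊M/Nᵉ⌋ + 1`; hence the CERTIFIED BOUNDS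
`(3q²)ᵉ·FS/M ≤ S e (p/q) ≤ (3q²)ᵉ·(FS + (2K+1)³)/M + hcpSumTail e K` (`hcpSumS_ge_cert`, `hcpSumS_le_cert`).
[folklore]
-/

noncomputable section

namespace Summit.AtomisticToContinuum.Crystallization.Theorems.ExcessDecayLiouvilleCoarseGrains

open Finset

/-! ## The integer evaluator: soundness -/

/-- The integer numerator is `3q²·Q + 3p²k²`. [folklore] -/
theorem hcpSumNumZ_cast (p q : ℕ) (k i j : ℤ) :
    (hcpSumNumZ p q k i j : ℝ) = 3 * (q : ℝ) ^ 2 * hcpSumQ (k, i, j) + 3 * (p : ℝ) ^ 2 * (k : ℝ) ^ 2 := by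
  unfold hcpSumNumZ
  by_cases hk : Even k
  · rw [if_pos hk, hcpSumQ_even hk]; push_cast; ring
  · rw [if_neg hk, hcpSumQ_odd hk]; push_cast; ring

/-- For `c = p/q`: `Q + k²c² = N / (3q²)`. [folklore] -/
theorem hcpSum_r_eq (p : ℕ) {q : ℕ} (hq : 0 < q) (k i j : ℤ) :
    hcpSumQ (k, i, j) + (k : ℝ) ^ 2 * ((p : ℝ) / q) ^ 2 = (hcpSumNumZ p q k i j : ℝ) / (3 * (q : ℝ) ^ 2) := by
  have hq' : (q : ℝ) ≠ 0 := by positivity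
  rw [hcpSumNumZ_cast]
  field_simp

/-- The numerator is positive off the origin. [folklore] -/
theorem hcpSumNumZ_pos {p q : ℕ} (hp : 0 < p) (hq : 0 < q) {k i j : ℤ} (hv : ((k, i, j) : ℤ × ℤ × ℤ) ≠ 0) :
    0 < hcpSumNumZ p q k i j := by
  have h := hcpSum_r_pos (v := (k, i, j)) hv (c := (p : ℝ) / q) (by positivity)
  dsimp only at h
  rw [hcpSum_r_eq p hq] at h
  have h3 : (0 : ℝ) < 3 * (q : ℝ) ^ 2 := by positivity
  have h' : (0 : ℝ) < (hcpSumNumZ p q k i j : ℝ) := by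
    by_contra hcon
    push Not at hcon
    have := div_nonpos_of_nonpos_of_nonneg hcon h3.le
    linarith
  exact_mod_cast h'

/-- The term at `c = p/q` in terms of the numerator. [folklore] -/
theorem hcpSumTerm_eq_of_rat (p : ℕ) {q : ℕ} (hq : 0 < q) (e : ℕ) (v : ℤ × ℤ × ℤ) :
    hcpSumTerm e ((p : ℝ) / q) v =
      (3 * (q : ℝ) ^ 2) ^ e * (if v = 0 then 0 else (((hcpSumNumZ p q v.1 v.2.1 v.2.2 : ℝ))⁻¹) ^ e) := by
  obtain ⟨k, i, j⟩ := v
  unfold hcpSumTerm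
  split_ifs with hv
  · simp
  · dsimp only
    rw [hcpSum_r_eq p hq, inv_div, div_eq_mul_inv, mul_pow]

/-- Upper floor bound for one term. [folklore] -/
theorem hcpSumFloorTerm_le {p q : ℕ} (hp : 0 < p) (hq : 0 < q) (K e M kk ii jj : ℕ) :
    (hcpSumFloorTerm p q K e M kk ii jj : ℝ) ≤
      M * (if (((kk : ℤ) - K, (ii : ℤ) - K, (jj : ℤ) - K) : ℤ × ℤ × ℤ) = 0 then 0
        else (((hcpSumNumZ p q ((kk : ℤ) - K) ((ii : ℤ) - K) ((jj : ℤ) - K) : ℝ))⁻¹) ^ e) := by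
  unfold hcpSumFloorTerm
  by_cases h0 : kk = K ∧ ii = K ∧ jj = K
  · rw [if_pos h0]
    obtain ⟨rfl, rfl, rfl⟩ := h0
    simp
  · rw [if_neg h0]
    have hv : (((kk : ℤ) - K, (ii : ℤ) - K, (jj : ℤ) - K) : ℤ × ℤ × ℤ) ≠ 0 := by
      intro h
      simp only [Prod.mk_eq_zero, sub_eq_zero] at h
      omega
    rw [if_neg hv]
    have hN := hcpSumNumZ_pos hp hq hv
    set N := hcpSumNumZ p q ((kk : ℤ) - K) ((ii : ℤ) - K) ((jj : ℤ) - K) with hNdef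
    have hNc : ((N.toNat : ℕ) : ℝ) = (N : ℝ) := by
      have : ((N.toNat : ℕ) : ℤ) = N := Int.toNat_of_nonneg hN.le
      exact_mod_cast this
    have hd : (0 : ℝ) < (N : ℝ) ^ e := by
      have : (0 : ℝ) < (N : ℝ) := by exact_mod_cast hN
      positivity
    calc ((M / N.toNat ^ e : ℕ) : ℝ) ≤ (M : ℝ) / ((N.toNat ^ e : ℕ) : ℝ) := Nat.cast_div_le
      _ = M * ((N : ℝ)⁻¹) ^ e := by rw [Nat.cast_pow, hNc, inv_pow, div_eq_mul_inv]

/-- Lower floor bound for one term. [folklore] -/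
theorem hcpSum_le_hcpSumFloorTerm_add_one {p q : ℕ} (hp : 0 < p) (hq : 0 < q) (K e M kk ii jj : ℕ) :
    M * (if (((kk : ℤ) - K, (ii : ℤ) - K, (jj : ℤ) - K) : ℤ × ℤ × ℤ) = 0 then 0
        else (((hcpSumNumZ p q ((kk : ℤ) - K) ((ii : ℤ) - K) ((jj : ℤ) - K) : ℝ))⁻¹) ^ e) ≤
      (hcpSumFloorTerm p q K e M kk ii jj : ℝ) + 1 := by
  unfold hcpSumFloorTerm
  by_cases h0 : kk = K ∧ ii = K ∧ jj = K
  · rw [if_pos h0]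
    obtain ⟨rfl, rfl, rfl⟩ := h0
    simp
  · rw [if_neg h0]
    have hv : (((kk : ℤ) - K, (ii : ℤ) - K, (jj : ℤ) - K) : ℤ × ℤ × ℤ) ≠ 0 := by
      intro h
      simp only [Prod.mk_eq_zero, sub_eq_zero] at h
      omega
    rw [if_neg hv]
    have hN := hcpSumNumZ_pos hp hq hv
    set N := hcpSumNumZ p q ((kk : ℤ) - K) ((ii : ℤ) - K) ((jj : ℤ) - K) with hNdef
    have hNc : ((N.toNat : ℕ) : ℝ) = (N : ℝ) := by
      have : ((N.toNat : ℕ) : ℤ) = N := Int.toNat_of_nonneg hN.le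
      exact_mod_cast this
    have hNpos : (0 : ℝ) < (N : ℝ) := by exact_mod_cast hN
    set d : ℕ := N.toNat ^ e with hddef
    have hdc : (d : ℝ) = (N : ℝ) ^ e := by rw [hddef, Nat.cast_pow, hNc]
    have hdpos : (0 : ℝ) < d := by rw [hdc]; positivity
    have hdiv := Nat.div_add_mod M d
    have hmod := Nat.mod_lt M (show 0 < d by exact_mod_cast hdpos)
    have hreal : (M : ℝ) < (d : ℝ) * ((M / d : ℕ) : ℝ) + d := by
      have : (M : ℝ) = (d : ℝ) * ((M / d : ℕ) : ℝ) + ((M % d : ℕ) : ℝ) := by exact_mod_cast hdiv.symm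
      have h2 : ((M % d : ℕ) : ℝ) < d := by exact_mod_cast hmod
      linarith
    have key : (M : ℝ) * ((N : ℝ)⁻¹) ^ e = (M : ℝ) / d := by rw [hdc, inv_pow, div_eq_mul_inv]
    rw [key, div_le_iff₀ hdpos]
    nlinarith

/-- The inner loop is a `Finset.range` sum. [folklore] -/
theorem hcpSumLoopJ_eq (p q K e M kk ii n : ℕ) :
    hcpSumLoopJ p q K e M kk ii n = ∑ jj ∈ Finset.range n, hcpSumFloorTerm p q K e M kk ii jj := by
  induction n with
  | zero => rfl
  | succ n ih => rw [hcpSumLoopJ, ih, Finset.sum_range_succ]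

/-- The middle loop is a `Finset.range` sum. [folklore] -/
theorem hcpSumLoopI_eq (p q K e M kk n : ℕ) :
    hcpSumLoopI p q K e M kk n =
      ∑ ii ∈ Finset.range n, ∑ jj ∈ Finset.range (2 * K + 1), hcpSumFloorTerm p q K e M kk ii jj := by
  induction n with
  | zero => rfl
  | succ n ih => rw [hcpSumLoopI, ih, Finset.sum_range_succ, hcpSumLoopJ_eq]

/-- The outer loop is a `Finset.range` sum. [folklore] -/
theorem hcpSumLoopK_eq (p q K e M n : ℕ) :
    hcpSumLoopK p q K e M n = ∑ kk ∈ Finset.range n, ∑ ii ∈ Finset.range (2 * K + 1),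
      ∑ jj ∈ Finset.range (2 * K + 1), hcpSumFloorTerm p q K e M kk ii jj := by
  induction n with
  | zero => rfl
  | succ n ih => rw [hcpSumLoopK, ih, Finset.sum_range_succ, hcpSumLoopI_eq]

/-- The floor sum as a triple `Finset.range` sum. [folklore] -/
theorem hcpSumFloorSum_eq (p q K e M : ℕ) :
    hcpSumFloorSum p q K e M = ∑ kk ∈ Finset.range (2 * K + 1), ∑ ii ∈ Finset.range (2 * K + 1),
      ∑ jj ∈ Finset.range (2 * K + 1), hcpSumFloorTerm p q K e M kk ii jj :=
  hcpSumLoopK_eq p q K e M _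

/-- `[-K,K] ⊆ ℤ` as the image of `range (2K+1)`. [folklore] -/
theorem hcpSum_Icc_eq_image_range (K : ℕ) :
    Finset.Icc (-(K : ℤ)) K = (Finset.range (2 * K + 1)).image fun kk : ℕ => (kk : ℤ) - K := by
  ext x
  simp only [Finset.mem_Icc, Finset.mem_image, Finset.mem_range]
  constructor
  · intro h
    exact ⟨(x + K).toNat, by omega, by omega⟩
  · rintro ⟨kk, hkk, rfl⟩
    omega

/-- Reindexing a sum over `[-K,K]` by `range (2K+1)`. [folklore] -/
theorem hcpSum_sum_Icc_eq_sum_range (K : ℕ) (g : ℤ → ℝ) :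
    ∑ k ∈ Finset.Icc (-(K : ℤ)) K, g k = ∑ kk ∈ Finset.range (2 * K + 1), g ((kk : ℤ) - K) := by
  rw [hcpSum_Icc_eq_image_range, Finset.sum_image]
  intro a _ b _ h
  have : (a : ℤ) = b := by linarith
  exact_mod_cast this

/-- **Reindexing the cube sum** by the shifted natural indices. [folklore] -/
theorem hcpSum_sum_hcpSumCube_eq_sum_range (K : ℕ) (F : ℤ × ℤ × ℤ → ℝ) :
    ∑ v ∈ hcpSumCube K, F v = ∑ kk ∈ Finset.range (2 * K + 1), ∑ ii ∈ Finset.range (2 * K + 1),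
      ∑ jj ∈ Finset.range (2 * K + 1), F ((kk : ℤ) - K, (ii : ℤ) - K, (jj : ℤ) - K) := by
  unfold hcpSumCube
  rw [Finset.sum_product, hcpSum_sum_Icc_eq_sum_range]
  refine Finset.sum_congr rfl fun kk _ => ?_
  rw [Finset.sum_product, hcpSum_sum_Icc_eq_sum_range]
  refine Finset.sum_congr rfl fun ii _ => ?_
  rw [hcpSum_sum_Icc_eq_sum_range]

/-- **Floor sum, upper soundness**: `FS ≤ M · ∑_{cube} [v ≠ 0] N_v^{-e}`. [folklore] -/
theorem hcpSumFloorSum_le {p q : ℕ} (hp : 0 < p) (hq : 0 < q) (K e M : ℕ) :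
    (hcpSumFloorSum p q K e M : ℝ) ≤
      M * ∑ v ∈ hcpSumCube K, (if v = 0 then 0 else (((hcpSumNumZ p q v.1 v.2.1 v.2.2 : ℝ))⁻¹) ^ e) := by
  rw [hcpSumFloorSum_eq, hcpSum_sum_hcpSumCube_eq_sum_range, Finset.mul_sum]
  push_cast
  refine Finset.sum_le_sum fun kk _ => ?_
  rw [Finset.mul_sum]
  refine Finset.sum_le_sum fun ii _ => ?_
  rw [Finset.mul_sum]
  refine Finset.sum_le_sum fun jj _ => ?_
  exact hcpSumFloorTerm_le hp hq K e M kk ii jj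

/-- **Floor sum, lower soundness**: `M · ∑_{cube} [v ≠ 0] N_v^{-e} ≤ FS + (2K+1)³`. [folklore] -/
theorem hcpSum_le_hcpSumFloorSum_add {p q : ℕ} (hp : 0 < p) (hq : 0 < q) (K e M : ℕ) :
    M * ∑ v ∈ hcpSumCube K, (if v = 0 then 0 else (((hcpSumNumZ p q v.1 v.2.1 v.2.2 : ℝ))⁻¹) ^ e) ≤
      (hcpSumFloorSum p q K e M : ℝ) + (2 * K + 1) ^ 3 := by
  have hcount : (2 * (K : ℝ) + 1) ^ 3 = ∑ _kk ∈ Finset.range (2 * K + 1),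
      ∑ _ii ∈ Finset.range (2 * K + 1), ∑ _jj ∈ Finset.range (2 * K + 1), (1 : ℝ) := by
    simp only [Finset.sum_const, Finset.card_range, nsmul_eq_mul, mul_one]
    push_cast
    ring
  rw [hcpSumFloorSum_eq, hcpSum_sum_hcpSumCube_eq_sum_range, Finset.mul_sum]
  push_cast
  rw [hcount, ← Finset.sum_add_distrib]
  refine Finset.sum_le_sum fun kk _ => ?_
  rw [Finset.mul_sum, ← Finset.sum_add_distrib]
  refine Finset.sum_le_sum fun ii _ => ?_
  rw [Finset.mul_sum, ← Finset.sum_add_distrib]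
  refine Finset.sum_le_sum fun jj _ => ?_
  exact hcpSum_le_hcpSumFloorTerm_add_one hp hq K e M kk ii jj

/-- The cube sum of the terms at `c = p/q` in terms of the numerators. [folklore] -/
theorem hcpSum_sum_hcpSumCube_hcpSumTerm_eq (p : ℕ) {q : ℕ} (hq : 0 < q) (e K : ℕ) :
    ∑ v ∈ hcpSumCube K, hcpSumTerm e ((p : ℝ) / q) v =
      (3 * (q : ℝ) ^ 2) ^ e *
        ∑ v ∈ hcpSumCube K, (if v = 0 then 0 else (((hcpSumNumZ p q v.1 v.2.1 v.2.2 : ℝ))⁻¹) ^ e) := by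
  rw [Finset.mul_sum]
  exact Finset.sum_congr rfl fun v _ => hcpSumTerm_eq_of_rat p hq e v

/-- **Certified lower bound**: `(3q²)ᵉ · FS / M ≤ S e (p/q)`. [folklore] -/
theorem hcpSumS_ge_cert {e : ℕ} (he : 3 ≤ e) {p q : ℕ} (hp : 0 < p) (hq : 0 < q)
    (hc : 3 / 5 ≤ ((p : ℝ) / q) ^ 2) (K : ℕ) {M : ℕ} (hM : 0 < M) :
    (3 * (q : ℝ) ^ 2) ^ e * (hcpSumFloorSum p q K e M : ℝ) / M ≤ hcpSumS e ((p : ℝ) / q) := by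
  refine le_trans ?_ (hcpSum_cube_le_hcpSumS he hc K)
  rw [hcpSum_sum_hcpSumCube_hcpSumTerm_eq p hq, mul_div_assoc]
  refine mul_le_mul_of_nonneg_left ?_ (by positivity)
  rw [div_le_iff₀ (by exact_mod_cast hM)]
  have := hcpSumFloorSum_le hp hq K e M
  linarith

/-- **Certified upper bound**: `S e (p/q) ≤ (3q²)ᵉ (FS + (2K+1)³)/M + T(e,K)`. [folklore] -/
theorem hcpSumS_le_cert : ∀ {e : ℕ}, 3 ≤ e → ∀ {p q : ℕ}, 0 < p → 0 < q →
    3 / 5 ≤ ((p : ℝ) / q) ^ 2 → ∀ {K : ℕ}, 4 ≤ K → ∀ {M : ℕ}, 0 < M →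
    hcpSumS e ((p : ℝ) / q) ≤
      (3 * (q : ℝ) ^ 2) ^ e * ((hcpSumFloorSum p q K e M : ℝ) + (2 * K + 1) ^ 3) / M + hcpSumTail e K := by
  intro e he p q hp hq hc K hK M hM
  refine le_trans (hcpSumS_le_cube_add_tail he hc hK) ?_
  rw [hcpSum_sum_hcpSumCube_hcpSumTerm_eq p hq]
  refine add_le_add_left ?_ (hcpSumTail e K)
  rw [mul_div_assoc]
  refine mul_le_mul_of_nonneg_left ?_ (by positivity)
  rw [le_div_iff₀ (by exact_mod_cast hM)]
  have := hcpSum_le_hcpSumFloorSum_add hp hq K e M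
  linarith


end Summit.AtomisticToContinuum.Crystallization.Theorems.ExcessDecayLiouvilleCoarseGrains

end
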